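import Summits.RiemannHypothesis.RiemannHypothesis.Theorems.HardyZLehmerSplitSigmaLSmooth
import Summits.RiemannHypothesis.RiemannHypothesis.Theses.HardyZLehmerSplit
import Literature.NumberTheory.LFunctions.TuringMethod
import Literature.NumberTheory.LFunctions.RHWave0HardyProofs
import Literature.NumberTheory.LFunctions.RiemannSiegelPhase
import Literature.NumberTheory.LFunctions.ZetaRealAxis
import HarnessLib

/-!
# Crux `SigmaL` (stmt-RiemannHypothesis-24253) — the crux in `|Z|`-form: local minima of `|Z|` are
# zeros ⟺ Σ_L ⟺ one hump of `|Z|` per zero-free stretch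

Companion of `Theorems/HardyZLehmerSplitSigmaLLaguerreConeReductions.lean` §10 (the registered stub
`stub_laguerreAtCritical` = `SigmaL` + non-degeneracy of critical points). This module records the
classical GEOMETRIC reading of the crux `SigmaL` ("no Lehmer violation of Hardy's `Z` above `3·10¹²`":
a local minimum of `Z` has `Z ≤ 0`, a local maximum has `Z ≥ 0`), RH-free and by name:

* §11 pointwise: at any `t`, "no wrong-sign extremum of `Z` at `t`" ⟺ "if `|Z|` has a local minimum
  at `t` then `Z(t) = 0`" (`noViolationAt_iff_abs`); hence
  `SigmaL ⟺ ∀ t > 3·10¹², IsLocalMin |Z| t → Z t = 0` (`SigmaL_iff_abs`: **every local minimum of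
  `|Z|` above `3·10¹²` is a zero of `Z`** — the graph of `|Z|` never dips without touching the axis);
* §12 interval form: `SigmaL ⟺` **on every interval `[a, b]`, `a ≥ 3·10¹²`, on whose interior `Z` has
  no zero, `|Z|` is unimodal** — nondecreasing on `[a, c]` and nonincreasing on `[c, b]` for some
  `c ∈ [a, b]` (`SigmaL_iff_abs_unimodal`; `→` is compactness: an interior dip of a continuous
  function is an interior local minimum, `abs_unimodal_of_noAbsLocalMin`; `←` uses that the
  real-analytic `Z` (`contDiff_hardyZ`, `C^ω`) is locally constant nowhere — `Z(0) = ζ(½) < 0`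
  (`hardyZ_zero_neg`), `Z` has a zero (Hardy, tree `hardy_infinite_zeros_on_critical_line_holds`)
  and the identity principle
  (`eventually_ne_hardyZ`), so a local minimum on a monotone stretch is impossible,
  `not_isLocalMin_abs_of_unimodal`). Between two consecutive zeros of `Z` above `3·10¹²` this is the
  textbook picture "exactly one hump" (Edwards §8.3; Ivić 2003 §2, where RH ⟹ `Z'/Z` decreasing ⟹ one
  hump; here only the EQUIVALENCE with the crux is proved, unconditionally).

NOTHING HERE PROVES OR ASSUMES RH; `SigmaL` and `stub_laguerreAtCritical` stay OPEN (RH-strength above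
`H₀ − 1`, see `SigmaL_energy_bracket`, `laguerreAtCritical_of_exactCone`). A REFORMULATION aid
(`--supports` the item); credits nothing toward closing it. References: Edwards 1974 §8.3
[Edwards1974]; Ivić 2003 §2 [Ivic2003].
-/

set_option linter.dupNamespace false
set_option autoImplicit false

noncomputable section

open Filter Set
open scoped Topology
open Literature.NumberTheory.LFunctions
open Summit.RiemannHypothesis.RiemannHypothesis.Theses.HardyZLehmerSplit (SigmaL)

namespace Summit.RiemannHypothesis.RiemannHypothesis.Theorems.SigmaLBirth

/-! ## §11. The crux pointwise in `|Z|`-form -/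

/-- **No wrong-sign extremum of `Z` at `t` ⟺ a local minimum of `|Z|` at `t` forces `Z(t) = 0`.**
(`→`: if `|Z|` has a local minimum at `t` and `Z(t) > 0`, then `Z = |Z|` near `t` by continuity, so
`t` is a positive local minimum of `Z`; if `Z(t) < 0`, then `Z = −|Z|` near `t` and `t` is a negative
local maximum. `←`: a positive local minimum / negative local maximum of `Z` is a local minimum of
`|Z|` with `Z ≠ 0`.) Unconditional calculus (continuity of `Z`, tree `continuous_hardyZ`); nothing
here bears on the truth of RH. [folklore; cf. Edwards1974 §8.3] -/
theorem noViolationAt_iff_abs (t : ℝ) :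
    ((IsLocalMin hardyZ t → hardyZ t ≤ 0) ∧ (IsLocalMax hardyZ t → 0 ≤ hardyZ t)) ↔
    (IsLocalMin (fun u ↦ |hardyZ u|) t → hardyZ t = 0) := by
  have hc : ContinuousAt hardyZ t := continuous_hardyZ.continuousAt
  constructor
  · rintro ⟨hmin, hmax⟩ habs
    by_contra hne
    rcases lt_or_gt_of_ne hne with hneg | hpos
    · -- `Z t < 0`: near `t`, `Z < 0`, so `|Z| = -Z` and `t` is a local maximum of `Z`
      have hev : ∀ᶠ u in 𝓝 t, hardyZ u < 0 := hc.eventually (Iio_mem_nhds hneg)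
      have hM : IsLocalMax hardyZ t := by
        filter_upwards [habs, hev] with u hu hu'
        simp only [abs_of_neg hu', abs_of_neg hneg] at hu
        linarith
      exact absurd (hmax hM) (not_le.2 hneg)
    · -- `Z t > 0`: near `t`, `Z > 0`, so `|Z| = Z` and `t` is a local minimum of `Z`
      have hev : ∀ᶠ u in 𝓝 t, 0 < hardyZ u := hc.eventually (Ioi_mem_nhds hpos)
      have hm : IsLocalMin hardyZ t := by
        filter_upwards [habs, hev] with u hu hu'
        simp only [abs_of_pos hu', abs_of_pos hpos] at hu
        exact hu
      exact absurd (hmin hm) (not_le.2 hpos)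
  · intro h
    refine ⟨fun hmin ↦ ?_, fun hmax ↦ ?_⟩
    · by_contra hpos
      push Not at hpos
      have hev : ∀ᶠ u in 𝓝 t, 0 < hardyZ u := hc.eventually (Ioi_mem_nhds hpos)
      have habs : IsLocalMin (fun u ↦ |hardyZ u|) t := by
        filter_upwards [hmin, hev] with u hu hu'
        simp only [abs_of_pos hu', abs_of_pos hpos]
        exact hu
      exact absurd (h habs) hpos.ne'
    · by_contra hneg
      push Not at hneg
      have hev : ∀ᶠ u in 𝓝 t, hardyZ u < 0 := hc.eventually (Iio_mem_nhds hneg)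
      have habs : IsLocalMin (fun u ↦ |hardyZ u|) t := by
        filter_upwards [hmax, hev] with u hu hu'
        simp only [abs_of_neg hu', abs_of_neg hneg]
        linarith
      exact absurd (h habs) hneg.ne

/-- **`SigmaL` in `|Z|`-form: every local minimum of `|Z|` above `3·10¹²` is a zero of `Z`.**
`SigmaL ↔ ∀ t > 3·10¹², IsLocalMin |Z| t → Z(t) = 0` (pointwise from `noViolationAt_iff_abs`). The
classical phrasing of "no Lehmer violation": the graph of `|Z|` never dips without reaching the axis.
An EQUIVALENT restatement of the open crux, not a weakening; credits nothing toward closing it;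
nothing here bears on the truth of RH. [folklore; cf. Edwards1974 §8.3, Ivic2003 §2] -/
theorem SigmaL_iff_abs :
    SigmaL ↔ ∀ t : ℝ, 3000000000000 < t → IsLocalMin (fun u ↦ |hardyZ u|) t → hardyZ t = 0 :=
  ⟨fun hL t ht ↦ (noViolationAt_iff_abs t).1 (hL t ht),
    fun h t ht ↦ (noViolationAt_iff_abs t).2 (h t ht)⟩

/-! ## §12. Interval form: one hump of `|Z|` per zero-free stretch -/

/-- **Compactness step: no interior local minimum of `|Z|` off the zeros ⟹ `|Z|` is unimodal.** If on
the open interval `(a, b)` the function `Z` has no zero and `|Z|` has no local minimum, then for the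
point `c ∈ [a, b]` where the continuous `|Z|` attains its maximum on `[a, b]`, `|Z|` is nondecreasing
on `[a, c]` and nonincreasing on `[c, b]`: a dip `|Z|(x) > |Z|(y)` with `x < y ≤ c` would put the
minimum of `|Z|` on `[x, c]` strictly inside `(x, c) ⊆ (a, b)`, an interior local minimum
(`IsMinOn.isLocalMin`), and symmetrically on `[c, b]`. Pure real analysis on the continuous `Z`;
nothing here bears on the truth of RH. [folklore] -/
theorem abs_unimodal_of_noAbsLocalMin {a b : ℝ} (hab : a ≤ b)
    (hZ : ∀ t ∈ Ioo a b, hardyZ t ≠ 0)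
    (h : ∀ t ∈ Ioo a b, IsLocalMin (fun u ↦ |hardyZ u|) t → hardyZ t = 0) :
    ∃ c ∈ Icc a b, MonotoneOn (fun u ↦ |hardyZ u|) (Icc a c) ∧
      AntitoneOn (fun u ↦ |hardyZ u|) (Icc c b) := by
  set f : ℝ → ℝ := fun u ↦ |hardyZ u| with hf
  have hfc : Continuous f := continuous_abs.comp continuous_hardyZ
  obtain ⟨c, hc, hcmax⟩ :=
    isCompact_Icc.exists_isMaxOn (nonempty_Icc.2 hab) hfc.continuousOn
  refine ⟨c, hc, ?_, ?_⟩
  · intro x hx y hy hxy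
    by_contra hlt
    push Not at hlt
    obtain ⟨m, hm, hmmin⟩ :=
      isCompact_Icc.exists_isMinOn (nonempty_Icc.2 hx.2 : (Icc x c).Nonempty) hfc.continuousOn
    have h1 : f m ≤ f y := hmmin ⟨hxy, hy.2⟩
    have h2 : f x ≤ f c := hcmax ⟨hx.1, hx.2.trans hc.2⟩
    have hmx : m ≠ x := fun e ↦ by rw [e] at h1; exact absurd (h1.trans_lt hlt) (lt_irrefl _)
    have hmc : m ≠ c := fun e ↦ by
      rw [e] at h1; exact absurd ((h2.trans h1).trans_lt hlt) (lt_irrefl _)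
    have hm' : m ∈ Ioo x c := ⟨lt_of_le_of_ne hm.1 hmx.symm, lt_of_le_of_ne hm.2 hmc⟩
    have hmab : m ∈ Ioo a b := ⟨lt_of_le_of_lt hx.1 hm'.1, lt_of_lt_of_le hm'.2 hc.2⟩
    have hloc : IsLocalMin f m := hmmin.isLocalMin (Icc_mem_nhds hm'.1 hm'.2)
    exact hZ m hmab (h m hmab hloc)
  · intro x hx y hy hxy
    by_contra hlt
    push Not at hlt
    obtain ⟨m, hm, hmmin⟩ :=
      isCompact_Icc.exists_isMinOn (nonempty_Icc.2 hy.1 : (Icc c y).Nonempty) hfc.continuousOn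
    have h1 : f m ≤ f x := hmmin ⟨hx.1, hxy⟩
    have h2 : f y ≤ f c := hcmax ⟨hc.1.trans hy.1, hy.2⟩
    have hmy : m ≠ y := fun e ↦ by rw [e] at h1; exact absurd (h1.trans_lt hlt) (lt_irrefl _)
    have hmc : m ≠ c := fun e ↦ by
      rw [e] at h1; exact absurd ((h2.trans h1).trans_lt hlt) (lt_irrefl _)
    have hm' : m ∈ Ioo c y := ⟨lt_of_le_of_ne hm.1 hmc.symm, lt_of_le_of_ne hm.2 hmy⟩
    have hmab : m ∈ Ioo a b := ⟨lt_of_le_of_lt hc.1 hm'.1, lt_of_lt_of_le hm'.2 hy.2⟩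
    have hloc : IsLocalMin f m := hmmin.isLocalMin (Icc_mem_nhds hm'.1 hm'.2)
    exact hZ m hmab (h m hmab hloc)

/-- **`SigmaL ⟹` one hump of `|Z|` per zero-free stretch above `3·10¹²`:** under the crux, on every
`[a, b]` with `a ≥ 3·10¹²` on whose interior `Z` has no zero, `|Z|` is nondecreasing on `[a, c]` and
nonincreasing on `[c, b]` for some `c ∈ [a, b]` (`SigmaL_iff_abs` + `abs_unimodal_of_noAbsLocalMin`).
In particular between two consecutive zeros of `Z` above `3·10¹²` the graph of `|Z|` rises to a single
maximum and falls back (Edwards §8.3's picture, which RH implies via Ivić's Prop. 1; here stated as a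
CONSEQUENCE of the open crux, unconditionally). Credits nothing; nothing here bears on the truth of RH.
[folklore; cf. Edwards1974 §8.3] -/
theorem abs_unimodal_of_SigmaL (hL : SigmaL) :
    ∀ a b : ℝ, 3000000000000 ≤ a → a ≤ b → (∀ t ∈ Ioo a b, hardyZ t ≠ 0) →
      ∃ c ∈ Icc a b, MonotoneOn (fun u ↦ |hardyZ u|) (Icc a c) ∧
        AntitoneOn (fun u ↦ |hardyZ u|) (Icc c b) :=
  fun _a _b ha hab hZ ↦ abs_unimodal_of_noAbsLocalMin hab hZ
    fun t ht hmin ↦ SigmaL_iff_abs.1 hL t (lt_of_le_of_lt ha ht.1) hmin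

/-- **`Z(0) = ζ(½) < 0`** (`θ(0) = 0`, tree `riemannSiegelTheta_zero`, and `ζ(σ) < 0` for real
`0 < σ < 1`, tree `riemannZeta_re_neg_of_pos_of_lt_one`). Numerically `Z(0) = −1.4603…`.
[cite: Titchmarsh1986, §2.12 (text after (2.12.4))] -/
theorem hardyZ_zero_neg : hardyZ 0 < 0 := by
  have e : hardyZ 0 = (riemannZeta (((1 / 2 : ℝ) : ℂ))).re := by
    simp [hardyZ]
  rw [e]
  exact riemannZeta_re_neg_of_pos_of_lt_one (by norm_num) (by norm_num)

/-- **`Z` is locally constant nowhere: near every `t`, eventually (on the punctured neighbourhood)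
`Z(u) ≠ Z(t)`.** `Z` is real-analytic on `ℝ` (tree `contDiff_hardyZ` at `ω`, Mathlib
`ContDiff.analyticOnNhd`), so by the identity principle (`AnalyticOnNhd.eq_of_frequently_eq`) a value
taken frequently near `t` is taken everywhere — impossible since `Z(0) < 0` (`hardyZ_zero_neg`) while
`Z` has a zero (Hardy 1914, tree `hardy_infinite_zeros_on_critical_line_holds`, with
`hardyZ_eq_zero_iff_holds`). Unconditional; nothing here bears on the truth of RH. [folklore] -/
theorem eventually_ne_hardyZ (t : ℝ) : ∀ᶠ u in 𝓝[≠] t, hardyZ u ≠ hardyZ t := by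
  by_contra hne
  have hfr : ∃ᶠ u in 𝓝[≠] t, hardyZ u = hardyZ t := by
    simpa [Filter.not_eventually] using hne
  have han : AnalyticOnNhd ℝ hardyZ univ := (contDiff_hardyZ (n := ⊤)).analyticOnNhd
  have hconst : hardyZ = fun _ ↦ hardyZ t :=
    han.eq_of_frequently_eq analyticOnNhd_const hfr
  obtain ⟨γ, hγ⟩ := hardy_infinite_zeros_on_critical_line_holds.nonempty
  have hγ' : riemannZeta (1 / 2 + γ * Complex.I) = 0 := hγ
  have hZγ : hardyZ γ = 0 := (hardyZ_eq_zero_iff_holds γ).2 hγ'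
  have e0 : hardyZ 0 = hardyZ t := congrFun hconst 0
  have eγ : hardyZ γ = hardyZ t := congrFun hconst γ
  have h0 := hardyZ_zero_neg
  linarith

/-- **On a unimodal stretch `|Z|` has no interior local minimum.** If `|Z|` is nondecreasing on
`[a, c]` and nonincreasing on `[c, b]` (any `c`), then no `t ∈ (a, b)` is a local minimum of
`|Z|`: for `t < c` a local minimum on the nondecreasing stretch makes `|Z|` constant on a left
punctured neighbourhood of `t`, for `t ≥ c` on a right one; either way `Z = ±Z(t)` there, and by
continuity `Z = Z(t)` frequently near `t`, contradicting `eventually_ne_hardyZ`. Unconditional;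
nothing here bears on the truth of RH. [folklore] -/
theorem not_isLocalMin_abs_of_unimodal {a b c t : ℝ} (ht : t ∈ Ioo a b)
    (hmono : MonotoneOn (fun u ↦ |hardyZ u|) (Icc a c))
    (hanti : AntitoneOn (fun u ↦ |hardyZ u|) (Icc c b)) :
    ¬ IsLocalMin (fun u ↦ |hardyZ u|) t := by
  intro hmin
  -- Step 1: `|Z u| = |Z t|` frequently on the punctured neighbourhood of `t`.
  have key : ∃ᶠ u in 𝓝[≠] t, |hardyZ u| = |hardyZ t| := by
    have hmin' : ∀ᶠ u in 𝓝 t, |hardyZ t| ≤ |hardyZ u| := hmin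
    rcases lt_or_ge t c with htc | hct
    · -- `t < c`: on the left of `t`, monotonicity gives `|Z u| ≤ |Z t|`
      have hI : ∀ᶠ u in 𝓝[<] t, a < u :=
        mem_nhdsWithin_of_mem_nhds (Ioi_mem_nhds ht.1)
      have h1 : ∀ᶠ u in 𝓝[<] t, |hardyZ u| = |hardyZ t| := by
        filter_upwards [nhdsWithin_le_nhds hmin', hI, self_mem_nhdsWithin] with u hu hau hut
        have hut' : u < t := hut
        have hle : |hardyZ u| ≤ |hardyZ t| :=
          hmono ⟨hau.le, hut'.le.trans htc.le⟩ ⟨ht.1.le, htc.le⟩ hut'.le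
        exact le_antisymm hle hu
      exact h1.frequently.filter_mono (nhdsWithin_mono _ fun u hu ↦ ne_of_lt hu)
    · -- `c ≤ t`: on the right of `t`, antitonicity gives `|Z u| ≤ |Z t|`
      have hI : ∀ᶠ u in 𝓝[>] t, u < b :=
        mem_nhdsWithin_of_mem_nhds (Iio_mem_nhds ht.2)
      have h1 : ∀ᶠ u in 𝓝[>] t, |hardyZ u| = |hardyZ t| := by
        filter_upwards [nhdsWithin_le_nhds hmin', hI, self_mem_nhdsWithin] with u hu hub htu
        have htu' : t < u := htu
        have hle : |hardyZ u| ≤ |hardyZ t| :=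
          hanti ⟨hct, ht.2.le⟩ ⟨hct.trans htu'.le, hub.le⟩ htu'.le
        exact le_antisymm hle hu
      exact h1.frequently.filter_mono (nhdsWithin_mono _ fun u hu ↦ ne_of_gt hu)
  -- Step 2: upgrade to `Z u = Z t` frequently, using continuity (same sign near `t`).
  have hc' : ContinuousAt hardyZ t := continuous_hardyZ.continuousAt
  have hfr : ∃ᶠ u in 𝓝[≠] t, hardyZ u = hardyZ t := by
    by_cases hZt : hardyZ t = 0
    · refine key.mono fun u hu ↦ ?_
      rw [hZt, abs_zero, abs_eq_zero] at hu
      rw [hu, hZt]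
    · have hnear : ∀ᶠ u in 𝓝 t, |hardyZ u - hardyZ t| < |hardyZ t| := by
        have hb : Metric.ball (hardyZ t) |hardyZ t| ∈ 𝓝 (hardyZ t) :=
          Metric.ball_mem_nhds _ (abs_pos.2 hZt)
        exact (hc'.eventually hb).mono fun u hu ↦ by rwa [Real.dist_eq] at hu
      refine (key.and_eventually (nhdsWithin_le_nhds hnear)).mono fun u ⟨hu, hu'⟩ ↦ ?_
      rcases abs_eq_abs.1 hu with h | h
      · exact h
      · exfalso
        rw [h, show -hardyZ t - hardyZ t = -(2 * hardyZ t) by ring, abs_neg, abs_mul,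
          abs_two] at hu'
        linarith [abs_pos.2 hZt]
  exact hfr (eventually_ne_hardyZ t)

/-- **One hump per zero-free stretch ⟹ `SigmaL`:** if on every `[a, b]` with `a ≥ 3·10¹²` on whose
interior `Z` has no zero `|Z|` is unimodal, then the crux holds: a local minimum of `|Z|` at
`t > 3·10¹²` with `Z(t) ≠ 0` sits inside a small zero-free `(a, b)` with `a ≥ 3·10¹²` (continuity),
where `not_isLocalMin_abs_of_unimodal` forbids it; conclude by `SigmaL_iff_abs`. Unconditional
EQUIVALENCE bookkeeping; credits nothing toward the open crux; nothing here bears on the truth of RH.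
[folklore] -/
theorem SigmaL_of_abs_unimodal
    (h : ∀ a b : ℝ, 3000000000000 ≤ a → a ≤ b → (∀ t ∈ Ioo a b, hardyZ t ≠ 0) →
      ∃ c ∈ Icc a b, MonotoneOn (fun u ↦ |hardyZ u|) (Icc a c) ∧
        AntitoneOn (fun u ↦ |hardyZ u|) (Icc c b)) :
    SigmaL := by
  rw [SigmaL_iff_abs]
  intro t ht hmin
  by_contra hZt
  have hc' : ContinuousAt hardyZ t := continuous_hardyZ.continuousAt
  have hne : ∀ᶠ u in 𝓝 t, hardyZ u ≠ 0 := hc'.eventually_ne hZt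
  have hgt : ∀ᶠ u in 𝓝 t, (3000000000000 : ℝ) < u := Ioi_mem_nhds ht
  obtain ⟨ε, hε, hball⟩ := Metric.eventually_nhds_iff.1 (hne.and hgt)
  have hZ : ∀ u ∈ Ioo (t - ε / 2) (t + ε / 2), hardyZ u ≠ 0 := fun u hu ↦
    (hball (by rw [Real.dist_eq, abs_lt]; constructor <;> linarith [hu.1, hu.2])).1
  have ha : (3000000000000 : ℝ) ≤ t - ε / 2 :=
    (hball (y := t - ε / 2) (by rw [Real.dist_eq, abs_lt]; constructor <;> linarith)).2.le
  obtain ⟨c, -, hmono, hanti⟩ := h (t - ε / 2) (t + ε / 2) ha (by linarith) hZ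
  exact not_isLocalMin_abs_of_unimodal ⟨by linarith, by linarith⟩ hmono hanti hmin

/-- **`SigmaL ⟺ |Z|` is unimodal on every zero-free stretch above `3·10¹²`** (one hump between
consecutive zeros): the crux holds iff on every `[a, b]` with `a ≥ 3·10¹²` on whose interior `Z` has
no zero there is `c ∈ [a, b]` with `|Z|` nondecreasing on `[a, c]` and nonincreasing on `[c, b]`
(`abs_unimodal_of_SigmaL`, `SigmaL_of_abs_unimodal`). The classical geometric form of "no Lehmer
violation above `3·10¹²`" (Edwards §8.3; Ivić 2003 §2 proves the RH ⟹ direction of the picture);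
an EQUIVALENT restatement of the open crux, RH-free, by name; credits nothing toward closing it;
nothing here bears on the truth of RH. [folklore; cf. Edwards1974 §8.3, Ivic2003 §2] -/
theorem SigmaL_iff_abs_unimodal :
    SigmaL ↔ ∀ a b : ℝ, 3000000000000 ≤ a → a ≤ b → (∀ t ∈ Ioo a b, hardyZ t ≠ 0) →
      ∃ c ∈ Icc a b, MonotoneOn (fun u ↦ |hardyZ u|) (Icc a c) ∧
        AntitoneOn (fun u ↦ |hardyZ u|) (Icc c b) :=
  ⟨abs_unimodal_of_SigmaL, SigmaL_of_abs_unimodal⟩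

end Summit.RiemannHypothesis.RiemannHypothesis.Theorems.SigmaLBirth

end
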